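import Summits.Ventures.DiscreteObjects.UnitDistance.PlaneSqrt143Rup3
import Summits.Ventures.DiscreteObjects.UnitDistance.QuadraticFieldsAtlas
import Summits.Ventures.DiscreteObjects.UnitDistance.PlaneSqrt11Four
import Summits.Ventures.DiscreteObjects.UnitDistance.KernelRupCnfValid
import HarnessLib

/-!
# `4 ≤ χ(ℚ(√143)²) ≤ 5`: the plane over `ℚ(√143)` is not 3-colourable (cell `pub-namedobj`, target (U), seat udg g14)

Framing (verbatim for the cell): lottery ticket; floor = certified bounds/negative ranges.

The cell's atlas has only `χ(ℚ(√143)²) ≥ 3` (odd cycle, `143 ≡ 3 (mod 4)`) and `χ ≤ 5` (the 11-adic criterion,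
`colorable_five_plane_of_elevenAdic`, `143 = 11·13` with `−13 ≡ 3² (mod 11)`); no criterion in the tree gives `≤ 4`
(`143 ≡ 7 (mod 8)`, `143 ≡ 3 (mod 7)`) and udg g13's balls on dens `1, 5, 60` / `1, 5, 12, 25, 300` were 3-colourable.  Here the
lower bound is raised to `4` (udg g14); like `d = 47, 311` no 4-colouring of `ℚ(√143)²` is known.  The abstract
graph `w143Graph` on `Fin 683` (adjacency = the exact integer unit test `unitStep143` on the coordinate table of
`PlaneSqrt143WitnessData.lean`) is not 3-colourable (kernel RUP certificate `w143rup1 … w143rup6`, soundness `KRup.checkAll_sound`); the map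
`v ↦ pt143 (w143c v)` is a graph homomorphism into the unit-distance graph of `ℚ(√143)²` (`w143Hom`); hence `4 ≤ χ(ℚ(√143)²) ≤ 5`
(`chromaticNumber_plane_sqrt143_bounds`) and `χ(K²) ≥ 4` for every field `K ∋ √143`.  The witness is triangle-free, as is every unit-distance
graph over `ℚ(√143)` (`TriangleFreeFieldPlanes.lean`); Madore (arXiv:1509.07023 §2): 'practically the only two useful graphs known
in this context are the triangle and Moser's spindle' — this one is neither.  Value and witness not found in print (PROVISIONAL).
-/

noncomputable section

namespace Summit.Ventures.DiscreteObjects.UnitDistance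

open SimpleGraph KRup IntermediateField
open scoped IntermediateField

/- Meta-level `whnf` must never evaluate the clause store (linters and the elaborator `whnf` types of the shape
   `Store.All _ (Store.ofList …)`); the kernel facts are untouched by this local attribute. -/
attribute [local irreducible] Store.ofList

/-! ## The abstract witness graph -/

/-- The integer unit test never holds between a point and itself (`0 ≠ 3600`). -/
theorem unitStep143_self (p : ℤ × ℤ × ℤ × ℤ) : unitStep143 p p = false := by
  simp [unitStep143]

/-- The integer unit test is symmetric. -/
theorem unitStep143_comm (p q : ℤ × ℤ × ℤ × ℤ) : unitStep143 p q = unitStep143 q p := by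
  have h1 : (p.1 - q.1) ^ 2 + 143 * (p.2.1 - q.2.1) ^ 2 + (p.2.2.1 - q.2.2.1) ^ 2 + 143 * (p.2.2.2 - q.2.2.2) ^ 2 =
      (q.1 - p.1) ^ 2 + 143 * (q.2.1 - p.2.1) ^ 2 + (q.2.2.1 - p.2.2.1) ^ 2 + 143 * (q.2.2.2 - p.2.2.2) ^ 2 := by ring
  have h2 : (p.1 - q.1) * (p.2.1 - q.2.1) + (p.2.2.1 - q.2.2.1) * (p.2.2.2 - q.2.2.2) =
      (q.1 - p.1) * (q.2.1 - p.2.1) + (q.2.2.1 - p.2.2.1) * (q.2.2.2 - p.2.2.2) := by ring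
  simp only [unitStep143, h1, h2]

/-- THE WITNESS GRAPH `W_143` on `Fin 683`: `v ~ w` iff the exact unit test holds on the coordinate table. -/
def w143Graph : SimpleGraph (Fin 683) where
  Adj v w := unitStep143 (w143c v) (w143c w) = true
  symm := ⟨fun v w h => by rw [unitStep143_comm]; exact h⟩
  loopless := ⟨fun v h => by rw [unitStep143_self] at h; exact Bool.false_ne_true h⟩

/-- Adjacency of the witness graph is decidable (it is a Boolean test). -/
instance : DecidableRel w143Graph.Adj := fun v w => inferInstanceAs (Decidable (unitStep143 (w143c v) (w143c w) = true))

/-- Every clause of the 3-colouring CNF has an admissible shape (vertex / edge-of-the-graph / unit) — an instance of the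
general `KRup.cnfOfAdj_all_valid_of` (udg g14; no per-instance kernel evaluation). -/
theorem w143cnf_valid : (cnfOfAdj w143adj 683 0 15).all (validClause w143nb 683 0 15) = true :=
  cnfOfAdj_all_valid_of (fun _ _ hw => testBit_listBits_of_mem _ _ hw) _ _ _

/-- KERNEL FACT: the last piece of the certificate derives the empty clause. -/
theorem w143nil : ([] : List ℕ) ∈ w143steps6.map Prod.fst := by
  decide +kernel

set_option maxRecDepth 2000000 in
/-- `W_143` IS NOT 3-COLOURABLE (kernel RUP certificate + `KRup.checkAll_sound`; WLOG `0 ↦ 0`, `15 ↦ 1`). -/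
theorem not_colorable_three_w143Graph : ¬ w143Graph.Colorable 3 := by
  rintro ⟨C⟩
  have h01 : C ⟨0, by norm_num⟩ ≠ C ⟨15, by norm_num⟩ := C.valid w143_edge01
  obtain ⟨σ, hσ0, hσ1⟩ := exists_perm_fin3 _ _ h01
  let col : ℕ → ℕ := fun v => if h : v < 683 then (σ (C ⟨v, h⟩)).val else 0
  have hcol : ∀ v (h : v < 683), col v = (σ (C ⟨v, h⟩)).val := fun v h => dif_pos h
  have hP : Proper3 w143nb 683 col := by
    intro v hv
    refine ⟨by rw [hcol v hv]; exact (σ (C ⟨v, hv⟩)).isLt, ?_⟩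
    intro w hw hbit heq
    have hu := (w143_unit_of_testBit v w hv hbit).2
    have hvalid : C ⟨v, hv⟩ ≠ C ⟨w, hw⟩ := C.valid hu
    rw [hcol v hv, hcol w hw] at heq
    exact hvalid (σ.injective (Fin.ext heq)).symm
  have h0 : col 0 = 0 := by rw [hcol 0 (by norm_num), hσ0]; rfl
  have h1 : col 15 = 1 := by rw [hcol 15 (by norm_num), hσ1]; rfl
  have H0 := all_true_of_valid hP h0 h1 w143cnf_valid
  have A1 : ∀ C ∈ cnfOfAdj w143adj 683 0 15 ++ w143pre1, clauseTrue (assignOf col) C = true := by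
    intro C hC; rw [List.mem_append] at hC
    rcases hC with h | h
    · exact H0 C h
    · simp [w143pre1] at h
  have S1 : ∀ C ∈ w143steps1.map Prod.fst, clauseTrue (assignOf col) C = true :=
    checkAll_sound (σ := assignOf col) 659 14 (S := Store.ofList 14 (cnfOfAdj w143adj 683 0 15 ++ w143pre1))
      _ w143steps1 (Store.All.ofList 14 A1) w143rup1
  have A2 : ∀ C ∈ cnfOfAdj w143adj 683 0 15 ++ w143pre2, clauseTrue (assignOf col) C = true := by
    intro C hC
    simp only [w143pre2, List.mem_append] at hC
    rcases hC with h | h | h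
    · exact A1 C (List.mem_append.2 (Or.inl h))
    · exact A1 C (List.mem_append.2 (Or.inr h))
    · exact S1 C h
  have S2 : ∀ C ∈ w143steps2.map Prod.fst, clauseTrue (assignOf col) C = true :=
    checkAll_sound (σ := assignOf col) 659 14 (S := Store.ofList 14 (cnfOfAdj w143adj 683 0 15 ++ w143pre2))
      _ w143steps2 (Store.All.ofList 14 A2) w143rup2
  have A3 : ∀ C ∈ cnfOfAdj w143adj 683 0 15 ++ w143pre3, clauseTrue (assignOf col) C = true := by
    intro C hC
    simp only [w143pre3, List.mem_append] at hC
    rcases hC with h | h | h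
    · exact A2 C (List.mem_append.2 (Or.inl h))
    · exact A2 C (List.mem_append.2 (Or.inr h))
    · exact S2 C h
  have S3 : ∀ C ∈ w143steps3.map Prod.fst, clauseTrue (assignOf col) C = true :=
    checkAll_sound (σ := assignOf col) 659 14 (S := Store.ofList 14 (cnfOfAdj w143adj 683 0 15 ++ w143pre3))
      _ w143steps3 (Store.All.ofList 14 A3) w143rup3
  have A4 : ∀ C ∈ cnfOfAdj w143adj 683 0 15 ++ w143pre4, clauseTrue (assignOf col) C = true := by
    intro C hC
    simp only [w143pre4, List.mem_append] at hC
    rcases hC with h | h | h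
    · exact A3 C (List.mem_append.2 (Or.inl h))
    · exact A3 C (List.mem_append.2 (Or.inr h))
    · exact S3 C h
  have S4 : ∀ C ∈ w143steps4.map Prod.fst, clauseTrue (assignOf col) C = true :=
    checkAll_sound (σ := assignOf col) 659 14 (S := Store.ofList 14 (cnfOfAdj w143adj 683 0 15 ++ w143pre4))
      _ w143steps4 (Store.All.ofList 14 A4) w143rup4
  have A5 : ∀ C ∈ cnfOfAdj w143adj 683 0 15 ++ w143pre5, clauseTrue (assignOf col) C = true := by
    intro C hC
    simp only [w143pre5, List.mem_append] at hC
    rcases hC with h | h | h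
    · exact A4 C (List.mem_append.2 (Or.inl h))
    · exact A4 C (List.mem_append.2 (Or.inr h))
    · exact S4 C h
  have S5 : ∀ C ∈ w143steps5.map Prod.fst, clauseTrue (assignOf col) C = true :=
    checkAll_sound (σ := assignOf col) 659 14 (S := Store.ofList 14 (cnfOfAdj w143adj 683 0 15 ++ w143pre5))
      _ w143steps5 (Store.All.ofList 14 A5) w143rup5
  have A6 : ∀ C ∈ cnfOfAdj w143adj 683 0 15 ++ w143pre6, clauseTrue (assignOf col) C = true := by
    intro C hC
    simp only [w143pre6, List.mem_append] at hC
    rcases hC with h | h | h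
    · exact A5 C (List.mem_append.2 (Or.inl h))
    · exact A5 C (List.mem_append.2 (Or.inr h))
    · exact S5 C h
  have S6 : ∀ C ∈ w143steps6.map Prod.fst, clauseTrue (assignOf col) C = true :=
    checkAll_sound (σ := assignOf col) 659 14 (S := Store.ofList 14 (cnfOfAdj w143adj 683 0 15 ++ w143pre6))
      _ w143steps6 (Store.All.ofList 14 A6) w143rup6
  have hnil := S6 [] w143nil
  simp [clauseTrue] at hnil

/- (An explicit 4-colouring of `W_143` is not kernel-checked over `683²` pairs; `χ(W_143) = 4` is derived at the end of the
   file from the realisation and the upper bound for the plane.) -/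

/-! ## Realisation in `ℚ(√143)²` -/

/-- The plane point with integer data `(A, B, C, E)`: `((A + B√143)/60, (C + E√143)/60)`. -/
def pt143 (p : ℤ × ℤ × ℤ × ℤ) : EuclideanSpace ℝ (Fin 2) :=
  !₂[((p.1 : ℝ) + (p.2.1 : ℝ) * Real.sqrt 143) / 60, ((p.2.2.1 : ℝ) + (p.2.2.2 : ℝ) * Real.sqrt 143) / 60]

/-- The integer unit test implies unit distance. -/
theorem dist_pt143_eq_one {p q : ℤ × ℤ × ℤ × ℤ} (h : unitStep143 p q = true) : dist (pt143 p) (pt143 q) = 1 := by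
  obtain ⟨a, b, c, e⟩ := p
  obtain ⟨a', b', c', e'⟩ := q
  simp only [unitStep143, Bool.and_eq_true, beq_iff_eq] at h
  obtain ⟨h1, h2⟩ := h
  have s : Real.sqrt 143 ^ 2 = 143 := Real.sq_sqrt (by norm_num)
  have h1' : ((a' : ℝ) - a) ^ 2 + 143 * ((b' : ℝ) - b) ^ 2 + ((c' : ℝ) - c) ^ 2 + 143 * ((e' : ℝ) - e) ^ 2 = 3600 := by
    exact_mod_cast h1
  have h2' : ((a' : ℝ) - a) * ((b' : ℝ) - b) + ((c' : ℝ) - c) * ((e' : ℝ) - e) = 0 := by exact_mod_cast h2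
  have hd : dist (pt143 (a, b, c, e)) (pt143 (a', b', c', e')) ^ 2 = 1 := by
    rw [EuclideanSpace.dist_sq_eq, Fin.sum_univ_two, Real.dist_eq, Real.dist_eq, sq_abs, sq_abs]
    simp [pt143]
    linear_combination (1 / 3600 : ℝ) * h1' + (((b : ℝ) - b') ^ 2 + ((e : ℝ) - e') ^ 2) / 3600 * s +
      (2 * Real.sqrt 143 / 3600) * h2'
  exact (pow_eq_one_iff_of_nonneg dist_nonneg two_ne_zero).1 hd

/-- Every point `pt143 p` lies in `ℚ(√143)²`. -/
theorem pt143_mem (p : ℤ × ℤ × ℤ × ℤ) : pt143 p ∈ fieldPoints ℚ⟮Real.sqrt 143⟯ := by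
  have hs : Real.sqrt 143 ∈ ℚ⟮Real.sqrt 143⟯ := mem_adjoin_simple_self ℚ _
  intro i
  fin_cases i
  · change ((p.1 : ℝ) + (p.2.1 : ℝ) * Real.sqrt 143) / 60 ∈ ℚ⟮Real.sqrt 143⟯
    exact div_mem (add_mem (intCast_mem _ _) (mul_mem (intCast_mem _ _) hs)) (ofNat_mem _ 60)
  · change ((p.2.2.1 : ℝ) + (p.2.2.2 : ℝ) * Real.sqrt 143) / 60 ∈ ℚ⟮Real.sqrt 143⟯
    exact div_mem (add_mem (intCast_mem _ _) (mul_mem (intCast_mem _ _) hs)) (ofNat_mem _ 60)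

/-- The realisation homomorphism `W_143 →g Γ(ℚ(√143)²)`, `v ↦ pt143 (w143c v)`. -/
def w143Hom : w143Graph →g planeUnitDistanceGraph.induce (fieldPoints ℚ⟮Real.sqrt 143⟯) where
  toFun v := ⟨pt143 (w143c v), pt143_mem _⟩
  map_rel' h := dist_pt143_eq_one h

/-- THE PLANE OVER `ℚ(√143)` IS NOT 3-COLOURABLE. -/
theorem not_colorable_three_plane_sqrt143 :
    ¬ (planeUnitDistanceGraph.induce (fieldPoints ℚ⟮Real.sqrt 143⟯)).Colorable 3 :=
  fun h => not_colorable_three_w143Graph (h.of_hom w143Hom)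

/-- `4 ≤ χ(ℚ(√143)²) ≤ 5` (lower bound: the witness; upper bound: the 11-adic criterion `colorable_five_plane_of_elevenAdic` (`PadicPattern 11 {143}`)). -/
theorem chromaticNumber_plane_sqrt143_bounds :
    4 ≤ (planeUnitDistanceGraph.induce (fieldPoints ℚ⟮Real.sqrt 143⟯)).chromaticNumber ∧
      (planeUnitDistanceGraph.induce (fieldPoints ℚ⟮Real.sqrt 143⟯)).chromaticNumber ≤ 5 := by
  have h5 : (planeUnitDistanceGraph.induce (fieldPoints ℚ⟮Real.sqrt 143⟯)).Colorable 5 := by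
    have h := colorable_five_plane_of_elevenAdic {143} (by decide)
    rw [multiSqrtField_singleton, Nat.cast_ofNat] at h
    exact h
  refine ⟨?_, h5.chromaticNumber_le⟩
  by_contra hlt
  have hlt' : (planeUnitDistanceGraph.induce (fieldPoints ℚ⟮Real.sqrt 143⟯)).chromaticNumber < (3 : ℕ∞) + 1 :=
    lt_of_not_ge hlt
  have hle : (planeUnitDistanceGraph.induce (fieldPoints ℚ⟮Real.sqrt 143⟯)).chromaticNumber ≤ (3 : ℕ) :=
    Order.le_of_lt_add_one hlt'
  exact not_colorable_three_plane_sqrt143 (chromaticNumber_le_iff_colorable.mp hle)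

/-- Atlas form: `4 ≤ χ(ℚ(√d : d ∈ {143})²) ≤ 5`. -/
theorem chromaticNumber_plane_multiSqrtField_143_bounds :
    4 ≤ (planeUnitDistanceGraph.induce (fieldPoints (multiSqrtField {143}))).chromaticNumber ∧
      (planeUnitDistanceGraph.induce (fieldPoints (multiSqrtField {143}))).chromaticNumber ≤ 5 := by
  rw [multiSqrtField_singleton, Nat.cast_ofNat]
  exact chromaticNumber_plane_sqrt143_bounds

/-- Every field `K ⊇ ℚ(√143)` has `χ(K²) ≥ 4`. -/
theorem not_colorable_three_plane_of_sqrt143_mem (K : IntermediateField ℚ ℝ) (h : Real.sqrt 143 ∈ K) :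
    ¬ (planeUnitDistanceGraph.induce (fieldPoints K)).Colorable 3 := by
  have hle : ℚ⟮Real.sqrt 143⟯ ≤ K := adjoin_simple_le_iff.2 h
  exact fun hK => not_colorable_three_plane_sqrt143 (colorable_plane_of_le hle hK)

end Summit.Ventures.DiscreteObjects.UnitDistance
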